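import Literature.Analysis.FluidPDE.LongTimeAverageSlidingWindow
import Literature.Analysis.FluidPDE.LongTimeAverageSubadditive
import HarnessLib

/-!
# Route LimitingAbsorption (AnomalousDissipation) — `RelaxationBoundsInventory`, line `Sketch`,
stub `stub_longTimeAvgSupOfAe` (crux stmt-AnomalousDissipation-2940)

An almost-everywhere bound on a nonnegative observable bounds its long-time average: if
`g ≥ 0` everywhere, `K ≥ 0`, and `g ≤ K` a.e. on every window `(0, T)` (`T > 0`), then
`longTimeAvgSup g = limsup_{T → ∞} T⁻¹ ∫₀ᵀ g ≤ K` (`Literature.Analysis.FluidPDE.TurbWave0`,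
Doering–Foias 2002, §2). The tree's `longTimeAvgSup_le_const` needs a *pointwise* bound; the
crux only supplies `scalarL2Sq (θ t) ≤ K` for a.e. `t ∈ (0, T)`, hence this stub.

Proof: for `T > 0`, `∫₀ᵀ g = ∫_{(0,T]} g = ∫_{(0,T)} g` (`intervalIntegral.integral_of_le`,
`MeasureTheory.integral_Ioc_eq_integral_Ioo`). If `g` is integrable on `(0, T)` then
`∫_{(0,T)} g ≤ ∫_{(0,T)} K = K · T` (`MeasureTheory.integral_mono_ae`,
`Real.volume_real_Ioo_of_le`); otherwise the Bochner integral is the junk value `0 ≤ K · T`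
(`MeasureTheory.integral_undef`; this is where `K ≥ 0` enters). Dividing by `T` gives
`timeMean g T ≤ K` for every `T > 0`, and `longTimeAvgSup_le_of_eventually_le` (coboundedness
from `g ≥ 0`) concludes.

Sources: folklore (Cesàro means; Doering–Foias, J. Fluid Mech. 467 (2002), §2 for the running
means `⟨·⟩_T` and their `lim sup`).
-/

noncomputable section

open MeasureTheory Set Filter Function TopologicalSpace Topology
open scoped ENNReal NNReal InnerProductSpace BigOperators

namespace Summit.AnomalousDissipation.AnomalousDissipation.Theorems.RelaxationBoundsInventory.LongTimeAvgSupOfAe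

set_option linter.dupNamespace false

open Literature.Analysis Literature.Analysis.FluidPDE Literature.Analysis.FluidPDE.Torus

/-- An a.e. bound `g ≤ K` on `(0, T)` with `K ≥ 0` bounds the Bochner integral:
`∫_{(0,T)} g ≤ K · T` for `T ≥ 0` — also when `g` is *not* integrable on `(0, T)`, its integral
being then the junk value `0 ≤ K · T`. [folklore] -/
theorem setIntegral_Ioo_le_mul_of_ae_le {g : ℝ → ℝ} {K T : ℝ} (hK : 0 ≤ K) (hT : 0 ≤ T)
    (hle : ∀ᵐ t ∂(volume.restrict (Ioo 0 T)), g t ≤ K) :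
    ∫ t in Ioo 0 T, g t ≤ K * T := by
  by_cases hgi : IntegrableOn g (Ioo 0 T)
  · have hKi : IntegrableOn (fun _ : ℝ => K) (Ioo 0 T) :=
      integrableOn_const (by rw [Real.volume_Ioo]; exact ENNReal.ofReal_ne_top)
    calc ∫ t in Ioo 0 T, g t ≤ ∫ _ in Ioo 0 T, K := integral_mono_ae hgi hKi hle
      _ = K * T := by
          rw [setIntegral_const, Real.volume_real_Ioo_of_le hT, sub_zero, smul_eq_mul, mul_comm]
  · rw [integral_undef hgi]
    exact mul_nonneg hK hT

/-- For `T > 0`, an a.e. bound `g ≤ K` on `(0, T)` with `K ≥ 0` bounds the running mean: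
`timeMean g T = T⁻¹ ∫₀ᵀ g ≤ K` (junk case of a non-integrable `g` included). [folklore] -/
theorem timeMean_le_of_ae_le {g : ℝ → ℝ} {K T : ℝ} (hK : 0 ≤ K) (hT : 0 < T)
    (hle : ∀ᵐ t ∂(volume.restrict (Ioo 0 T)), g t ≤ K) :
    timeMean g T ≤ K := by
  have hint : ∫ t in Ioo 0 T, g t ≤ K * T := setIntegral_Ioo_le_mul_of_ae_le hK hT.le hle
  simp only [timeMean, intervalIntegral.integral_of_le hT.le, integral_Ioc_eq_integral_Ioo]
  calc T⁻¹ * ∫ t in Ioo 0 T, g t ≤ T⁻¹ * (K * T) :=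
        mul_le_mul_of_nonneg_left hint (inv_nonneg.2 hT.le)
    _ = K := by field_simp

/-- **S5 `stub_longTimeAvgSupOfAe`.** If `g ≥ 0` everywhere, `K ≥ 0`, and `g ≤ K` a.e. on every
window `(0, T)`, `T > 0`, then the `limsup` long-time average satisfies `longTimeAvgSup g ≤ K`
(`longTimeAvgSup g = limsup_{T → ∞} T⁻¹ ∫₀ᵀ g`; the running means are `≤ K` for every `T > 0`
by `timeMean_le_of_ae_le`, and `longTimeAvgSup_le_of_eventually_le` passes to the `limsup`,
coboundedness being automatic from `g ≥ 0`). [folklore] -/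
theorem stub_longTimeAvgSupOfAe {g : ℝ → ℝ} {K : ℝ} (hg : ∀ t, 0 ≤ g t) (hK : 0 ≤ K)
    (hle : ∀ T : ℝ, 0 < T → ∀ᵐ t ∂(volume.restrict (Ioo 0 T)), g t ≤ K) :
    longTimeAvgSup g ≤ K :=
  longTimeAvgSup_le_of_eventually_le hg
    ((eventually_gt_atTop 0).mono fun _T hT => timeMean_le_of_ae_le hK hT (hle _ hT))

end Summit.AnomalousDissipation.AnomalousDissipation.Theorems.RelaxationBoundsInventory.LongTimeAvgSupOfAe

end
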